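import Summits.CriticalPhenomena.PercolationContinuityZ3.Theorems.SahiMasterFamilyFCombOneSharedDict

/-!
# SCHEME Σ: the classes (S9a), (S9b) of `φ` — `T3⁻` rows with `z_I ∉ B⁰`, and the leavers (support file)

Support file (prover seat `prim-bnk-2`, gen 31–32; `--supports stmt-CriticalPhenomena-4575`).  Proof document
`run/shared/lean/prim/prim-l12/prim-bnk-2/PROOF-THEOREM-I1.md` §2 (✓adm) and §3 (injectivity).

A `T3⁻` unit `((x, y), 2)` with `e ∉ x` and `z_I ∉ B⁰|_R` has `e ∈ z` (`notMem_y_of_T3`) and `y_J ∈ a′ = σQ \ P` for the row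
pair `P = C⁰|_{J \ x_J} ⊆ Q = C¹|_{J \ x_J}`.  (S9a) `y_J ∉ A_{x_J}` (not a leaver): it goes to the `T3⁺` unit at
`(x, y_I ∪ M_{x_J}(y_J))`; (S9b) `y_J ∈ A_{x_J}` (a LEAVER): it goes to the `T1⁺` unit at `(Φ_ℓ(x_I) ∪ x' + e, y_I ∪ y')`
where `(y', x')` is the slot `ρ(x_J, z_J)` of LEMMA J** (`leaverMap`).  For each class: domain / value of `φ`, the class of the new
traces, admissibility, signature (`12`, `13`) and injectivity on the class (for leavers: the slot determines `(x_J, z_J)` by the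
bijectivity of `ρ`, hence the row, and then `Φ_ℓ` is injective).  No definitions; no `sorry`.
-/

namespace Summit.CriticalPhenomena.PercolationContinuityZ3.Theorems

namespace SahiFComb.Shift

open Finset FinsetFamily
open scoped Classical

variable {ι : Type*} [Fintype ι] [DecidableEq ι] [LinearOrder ι]

namespace OneShared

variable {S : OneShared ι}

/-- A `T3⁻` unit with `z_I ∉ B⁰|_R` has `e ∉ y` (else `z ∌ e` and `z ∈ B` would put `z_I` in `B⁰`). [this work] -/
theorem notMem_y_of_T3 {x y : Finset ι} (hu : ((x, y), 2) ∈ ThreePartition.negUnitSetF S.B S.C)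
    (hzI : (S.I \ (y ∩ S.I)) \ (x ∩ S.I) ∉ secLow (S.I \ (y ∩ S.I)) S.B) : S.e ∉ y := by
  rw [mem_negUnitSetF_iff] at hu
  obtain ⟨-, h⟩ := hu
  simp only at h
  rcases h with ⟨h0, -⟩ | ⟨h1, -⟩ | ⟨-, ⟨hzB, -⟩, -⟩
  · exact absurd h0 (by norm_num)
  · exact absurd h1 (by norm_num)
  intro hey
  have hzIeq : (x ∪ y)ᶜ ∩ S.I = (S.I \ (y ∩ S.I)) \ (x ∩ S.I) := compl_union_inter_eq x y S.I
  have hez : S.e ∉ (x ∪ y)ᶜ := by rw [mem_compl, not_not, mem_union]; exact Or.inr hey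
  have := (mem_B_iff_secLow hez (hzIeq ▸ sdiff_subset)).1 hzB
  rw [hzIeq] at this
  exact hzI this

/-! ### Class (S9a): `T3⁻`, `e ∈ z`, `z_I ∉ B⁰`, not a leaver -/

/-- (S9a) domain: `y_J ∈ (σQ \ P) \ A_{x_J}`. [this work] -/
theorem dom_S9a {x y : Finset ι} (hu : ((x, y), 2) ∈ ThreePartition.negUnitSetF S.B S.C) (hex : S.e ∉ x)
    (hzI : (S.I \ (y ∩ S.I)) \ (x ∩ S.I) ∉ secLow (S.I \ (y ∩ S.I)) S.B) (hL : ((x, y), 2) ∉ S.leaverSet) :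
    y ∩ S.J ∈ ((secHigh (S.J \ (x ∩ S.J)) S.e S.C).image (fun t => (S.J \ (x ∩ S.J)) \ t) \
      secLow (S.J \ (x ∩ S.J)) S.C) \ (S.dataJ (x ∩ S.J)).A := by
  have hey : S.e ∉ y := notMem_y_of_T3 hu hzI
  have hu' := hu
  rw [mem_negUnitSetF_iff] at hu
  obtain ⟨hxy, h⟩ := hu
  simp only at hxy h
  rcases h with ⟨h0, -⟩ | ⟨h1, -⟩ | ⟨-, ⟨-, hzC⟩, hyC⟩
  · exact absurd h0 (by norm_num)
  · exact absurd h1 (by norm_num)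
  have hez : S.e ∈ (x ∪ y)ᶜ := by rw [mem_compl, mem_union, not_or]; exact ⟨hex, hey⟩
  have hyJR : y ∩ S.J ⊆ S.J \ (x ∩ S.J) := inter_subset_sdiff_inter hxy.symm S.J
  have hzJ : (x ∪ y)ᶜ ∩ S.J = (S.J \ (x ∩ S.J)) \ (y ∩ S.J) := compl_union_inter_eq' x y S.J
  have hQR : ∀ s ∈ secHigh (S.J \ (x ∩ S.J)) S.e S.C, s ⊆ S.J \ (x ∩ S.J) := fun s hs => (mem_secHigh.1 hs).1
  have hA : y ∩ S.J ∉ (S.dataJ (x ∩ S.J)).A := fun h => hL ((S.mem_leaverSet _).2 ⟨hu', rfl, hex, hey, hzI, h⟩)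
  rw [mem_sdiff, mem_sdiff, mem_image_ground_sdiff _ hQR]
  refine ⟨⟨⟨hyJR, ?_⟩, fun h => hyC ((mem_C_iff_secLow hey hyJR).2 h)⟩, hA⟩
  rw [← hzJ]
  exact (mem_C_iff_secHigh hez (hzJ ▸ sdiff_subset)).1 hzC

/-- (S9a) the value of `φ`. [this work] -/
theorem phi_eq_S9a {x y : Finset ι} (hu : ((x, y), 2) ∈ ThreePartition.negUnitSetF S.B S.C) (hex : S.e ∉ x)
    (hzI : (S.I \ (y ∩ S.I)) \ (x ∩ S.I) ∉ secLow (S.I \ (y ∩ S.I)) S.B) (hL : ((x, y), 2) ∉ S.leaverSet) :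
    S.phi ((x, y), 2) = ((x, (y \ S.J) ∪ ((S.dataJ (x ∩ S.J)).Gb ⟨y ∩ S.J, dom_S9a hu hex hzI hL⟩ : Finset ι)), 2) := by
  unfold OneShared.phi
  simp only [hex, if_false, if_true, show ((2 : ℕ) = 0) = False by simp, show ((2 : ℕ) = 1) = False by simp, hzI, hL]
  rw [dif_pos (dom_S9a hu hex hzI hL)]

/-- (S9a) the new `J`-trace `g = M_{x_J}(y_J)` lies in `b′ = P \ σQ`. [this work] -/
theorem img_S9a {x y : Finset ι} (hu : ((x, y), 2) ∈ ThreePartition.negUnitSetF S.B S.C) (hex : S.e ∉ x)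
    (hzI : (S.I \ (y ∩ S.I)) \ (x ∩ S.I) ∉ secLow (S.I \ (y ∩ S.I)) S.B) (hL : ((x, y), 2) ∉ S.leaverSet) :
    ((S.dataJ (x ∩ S.J)).Gb ⟨y ∩ S.J, dom_S9a hu hex hzI hL⟩ : Finset ι) ⊆ S.J \ (x ∩ S.J) ∧
      ((S.dataJ (x ∩ S.J)).Gb ⟨y ∩ S.J, dom_S9a hu hex hzI hL⟩ : Finset ι) ∈ S.C ∧
      (S.J \ (x ∩ S.J)) \ ((S.dataJ (x ∩ S.J)).Gb ⟨y ∩ S.J, dom_S9a hu hex hzI hL⟩ : Finset ι) ∉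
        secHigh (S.J \ (x ∩ S.J)) S.e S.C := by
  have hQR : ∀ s ∈ secHigh (S.J \ (x ∩ S.J)) S.e S.C, s ⊆ S.J \ (x ∩ S.J) := fun s hs => (mem_secHigh.1 hs).1
  have hgmem := ((S.dataJ (x ∩ S.J)).Gb ⟨y ∩ S.J, dom_S9a hu hex hzI hL⟩).2
  rw [mem_sdiff, mem_image_ground_sdiff _ hQR, mem_secLow] at hgmem
  obtain ⟨⟨hgR, hgC⟩, hgn⟩ := hgmem
  exact ⟨hgR, hgC, fun h => hgn ⟨hgR, h⟩⟩

/-- **Class (S9a)**: a `T3⁻` unit with `e ∉ x`, `z_I ∉ B⁰|_R` which is not a leaver goes to the `T3⁺` unit at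
`(x, y_I ∪ M_{x_J}(y_J))`. [this work] -/
theorem phi_adm_S9a {x y : Finset ι} (hu : ((x, y), 2) ∈ ThreePartition.negUnitSetF S.B S.C) (hex : S.e ∉ x)
    (hzI : (S.I \ (y ∩ S.I)) \ (x ∩ S.I) ∉ secLow (S.I \ (y ∩ S.I)) S.B) (hL : ((x, y), 2) ∉ S.leaverSet) :
    S.phi ((x, y), 2) ∈ ThreePartition.posUnitSetF S.B S.C ∧ x ⊆ (S.phi ((x, y), 2)).1.1 ∧ y ⊆ (S.phi ((x, y), 2)).1.2 := by
  have hey : S.e ∉ y := notMem_y_of_T3 hu hzI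
  obtain ⟨hgR, hgC, hgn⟩ := img_S9a hu hex hzI hL
  have hgdom : y ∩ S.J ⊆ ((S.dataJ (x ∩ S.J)).Gb ⟨y ∩ S.J, dom_S9a hu hex hzI hL⟩ : Finset ι) :=
    (S.dataJ (x ∩ S.J)).hGb ⟨y ∩ S.J, dom_S9a hu hex hzI hL⟩
  rw [phi_eq_S9a hu hex hzI hL]
  set g := ((S.dataJ (x ∩ S.J)).Gb ⟨y ∩ S.J, dom_S9a hu hex hzI hL⟩ : Finset ι) with hg
  rw [mem_negUnitSetF_iff] at hu
  obtain ⟨hxy, h⟩ := hu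
  simp only at hxy h
  rcases h with ⟨h0, -⟩ | ⟨h1, -⟩ | ⟨-, ⟨hzB, -⟩, -⟩
  · exact absurd h0 (by norm_num)
  · exact absurd h1 (by norm_num)
  have hez : S.e ∈ (x ∪ y)ᶜ := by rw [mem_compl, mem_union, not_or]; exact ⟨hex, hey⟩
  have hgJ : g ⊆ S.J := hgR.trans sdiff_subset
  have hey' : S.e ∉ (y \ S.J) ∪ g := fun h => hey ((nf_mem_iff S.heJ hgJ).1 h)
  have hdisj' : Disjoint x ((y \ S.J) ∪ g) := (nf_disjoint hxy.symm hgR).symm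
  have hez' : S.e ∈ (x ∪ ((y \ S.J) ∪ g))ᶜ := by rw [mem_compl, mem_union, not_or]; exact ⟨hex, hey'⟩
  have hz'J : (x ∪ ((y \ S.J) ∪ g))ᶜ ∩ S.J = (S.J \ (x ∩ S.J)) \ g := nfy_compl_inter hgJ
  rw [mem_posUnitSetF_iff]
  refine ⟨⟨hdisj', Or.inr (Or.inr ⟨rfl, ⟨?_, ?_⟩, ?_⟩)⟩, subset_rfl, nf_subset hgdom⟩
  · -- `z' ∈ B`: same `I`-trace, `e` in both
    refine (memB_congr (s := (x ∪ y)ᶜ) ⟨fun _ => hez', fun _ => hez⟩ ?_).1 hzB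
    rw [compl_union_inter_eq' x y S.I, compl_union_inter_eq', nf_inter_other S.hIJ.symm hgJ]
  · -- `z' ∉ C` (`e ∈ z'`, upper section)
    intro hz'C
    have h1 := (mem_C_iff_secHigh hez' (hz'J ▸ sdiff_subset)).1 hz'C
    rw [hz'J] at h1
    exact hgn h1
  · -- `y' ∈ C`
    refine (mem_C_iff_secLow (R := S.J \ (x ∩ S.J)) hey' ?_).2 ?_
    · rw [nf_inter hgJ]; exact hgR
    · rw [nf_inter hgJ]; exact mem_secLow.2 ⟨hgR, hgC⟩

/-- (S9a) signature of the target: `12`. [this work] -/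
theorem sig_phi_S9a {x y : Finset ι} (hu : ((x, y), 2) ∈ ThreePartition.negUnitSetF S.B S.C) (hex : S.e ∉ x)
    (hzI : (S.I \ (y ∩ S.I)) \ (x ∩ S.I) ∉ secLow (S.I \ (y ∩ S.I)) S.B) (hL : ((x, y), 2) ∉ S.leaverSet) :
    S.sig (S.phi ((x, y), 2)) = 12 := by
  have hgJ := (img_S9a hu hex hzI hL).1.trans sdiff_subset
  rw [phi_eq_S9a hu hex hzI hL]
  refine S.sig_eq_12 rfl hex ?_
  show (S.I \ (((y \ S.J) ∪ _) ∩ S.I)) \ (x ∩ S.I) ∉ secLow (S.I \ (((y \ S.J) ∪ _) ∩ S.I)) S.B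
  rw [nf_inter_other S.hIJ.symm hgJ]; exact hzI

/-- (S9a) `φ` is injective on the class. [this work] -/
theorem inj_S9a {x₁ y₁ x₂ y₂ : Finset ι} (hu₁ : ((x₁, y₁), 2) ∈ ThreePartition.negUnitSetF S.B S.C) (hex₁ : S.e ∉ x₁)
    (hzI₁ : (S.I \ (y₁ ∩ S.I)) \ (x₁ ∩ S.I) ∉ secLow (S.I \ (y₁ ∩ S.I)) S.B) (hL₁ : ((x₁, y₁), 2) ∉ S.leaverSet)
    (hu₂ : ((x₂, y₂), 2) ∈ ThreePartition.negUnitSetF S.B S.C) (hex₂ : S.e ∉ x₂)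
    (hzI₂ : (S.I \ (y₂ ∩ S.I)) \ (x₂ ∩ S.I) ∉ secLow (S.I \ (y₂ ∩ S.I)) S.B) (hL₂ : ((x₂, y₂), 2) ∉ S.leaverSet)
    (h : S.phi ((x₁, y₁), 2) = S.phi ((x₂, y₂), 2)) : ((x₁, y₁), 2) = ((x₂, y₂), 2) := by
  have hey₁ : S.e ∉ y₁ := notMem_y_of_T3 hu₁ hzI₁
  have hey₂ : S.e ∉ y₂ := notMem_y_of_T3 hu₂ hzI₂
  rw [phi_eq_S9a hu₁ hex₁ hzI₁ hL₁, phi_eq_S9a hu₂ hex₂ hzI₂ hL₂] at h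
  simp only [Prod.mk.injEq, and_true] at h
  obtain ⟨rfl, hy⟩ := h
  have hg₁J := (img_S9a hu₁ hex₁ hzI₁ hL₁).1.trans sdiff_subset
  have hg₂J := (img_S9a hu₂ hex₂ hzI₂ hL₂).1.trans sdiff_subset
  have hJ : y₁ ∩ S.J = y₂ ∩ S.J :=
    congrArg Subtype.val ((S.dataJ _).Gb.injective (Subtype.ext (nf_eq_nf_inter hg₁J hg₂J hy)))
  have hI : y₁ ∩ S.I = y₂ ∩ S.I := nf_eq_nf_inter_other S.hIJ.symm hg₁J hg₂J hy
  rw [part_eq_of_traces (s := y₁) (s' := y₂) ⟨fun h => absurd h hey₁, fun h => absurd h hey₂⟩ hI hJ]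

/-! ### Class (S9b): the leavers -/

/-- (S9b) the value of `φ` on a leaver. [this work] -/
theorem phi_eq_S9b {x y : Finset ι} (hL : ((x, y), 2) ∈ S.leaverSet) :
    S.phi ((x, y), 2) =
      ((((S.dataI y).Φl ⟨x ∩ S.I, leaver_memI hL⟩ : Finset ι) ∪
          ((S.rout.ρ ⟨_, leaver_memP hL⟩ : ↥S.rout.𝓟) : Finset ι × Finset ι).2 ∪ {S.e},
        (y ∩ S.I) ∪ ((S.rout.ρ ⟨_, leaver_memP hL⟩ : ↥S.rout.𝓟) : Finset ι × Finset ι).1), 0) := by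
  rw [phi_eq_leaverMap hL, leaverMap_eq hL]

/-- (S9b) the new `I`-trace `g = Φ_ℓ(x_I)` lies in `T = σA`: `g ⊆ R`, `g ∈ σA`, `g ∈ Q`, `σ g ∉ P`. [this work] -/
theorem img_S9b_I {x y : Finset ι} (hL : ((x, y), 2) ∈ S.leaverSet) :
    ((S.dataI y).Φl ⟨x ∩ S.I, leaver_memI hL⟩ : Finset ι) ⊆ S.I \ (y ∩ S.I) ∧
      ((S.dataI y).Φl ⟨x ∩ S.I, leaver_memI hL⟩ : Finset ι) ∈ (S.dataI y).A.image (fun t => (S.I \ (y ∩ S.I)) \ t) ∧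
      ((S.dataI y).Φl ⟨x ∩ S.I, leaver_memI hL⟩ : Finset ι) ∈ secHigh (S.I \ (y ∩ S.I)) S.e S.B ∧
      (S.I \ (y ∩ S.I)) \ ((S.dataI y).Φl ⟨x ∩ S.I, leaver_memI hL⟩ : Finset ι) ∉ secLow (S.I \ (y ∩ S.I)) S.B := by
  set dI := S.dataI y with hdI
  have hQR : ∀ s ∈ secHigh (S.I \ (y ∩ S.I)) S.e S.B, s ⊆ S.I \ (y ∩ S.I) := fun s hs => (mem_secHigh.1 hs).1
  have hσQR : ∀ s ∈ (secHigh (S.I \ (y ∩ S.I)) S.e S.B).image (fun t => (S.I \ (y ∩ S.I)) \ t), s ⊆ S.I \ (y ∩ S.I) :=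
    fun s hs => ((mem_image_ground_sdiff _ hQR).1 hs).1
  have hAR : ∀ s ∈ dI.A, s ⊆ S.I \ (y ∩ S.I) := fun s hs => hσQR s (mem_sdiff.1 (dI.hAa hs)).1
  have hgmem : (dI.Φl ⟨x ∩ S.I, leaver_memI hL⟩ : Finset ι) ∈ dI.A.image (fun t => (S.I \ (y ∩ S.I)) \ t) :=
    (dI.Φl ⟨x ∩ S.I, leaver_memI hL⟩).2
  have hg := hgmem
  rw [mem_image_ground_sdiff _ hAR] at hg
  obtain ⟨hgR, hgA⟩ := hg
  have hσg := dI.hAa hgA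
  rw [mem_sdiff, mem_image_ground_sdiff _ hQR, sdiff_sdiff_right_self, inf_eq_inter, inter_eq_right.2 hgR] at hσg
  obtain ⟨⟨-, hgQ⟩, hσgP⟩ := hσg
  exact ⟨hgR, hgmem, hgQ, hσgP⟩

/-- (S9b) the slot `(y', x') = ρ(x_J, z_J)`: `y', x' ⊆ J` disjoint, `J \ (y' ∪ x') ∈ A_{y'}`, `x' ∈ Q_{y'} = C¹|_{J \ y'}`,
`x_J ⊆ x'`, `y_J ⊆ y'`. [this work] -/
theorem img_S9b_slot {x y : Finset ι} (hL : ((x, y), 2) ∈ S.leaverSet) :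
    ((S.rout.ρ ⟨_, leaver_memP hL⟩ : ↥S.rout.𝓟) : Finset ι × Finset ι).1 ⊆ S.J ∧
      ((S.rout.ρ ⟨_, leaver_memP hL⟩ : ↥S.rout.𝓟) : Finset ι × Finset ι).2 ⊆ S.J ∧
      Disjoint ((S.rout.ρ ⟨_, leaver_memP hL⟩ : ↥S.rout.𝓟) : Finset ι × Finset ι).1
        ((S.rout.ρ ⟨_, leaver_memP hL⟩ : ↥S.rout.𝓟) : Finset ι × Finset ι).2 ∧
      ((S.rout.ρ ⟨_, leaver_memP hL⟩ : ↥S.rout.𝓟) : Finset ι × Finset ι).2 ∈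
        secHigh (S.J \ ((S.rout.ρ ⟨_, leaver_memP hL⟩ : ↥S.rout.𝓟) : Finset ι × Finset ι).1) S.e S.C ∧
      x ∩ S.J ⊆ ((S.rout.ρ ⟨_, leaver_memP hL⟩ : ↥S.rout.𝓟) : Finset ι × Finset ι).2 ∧
      y ∩ S.J ⊆ ((S.rout.ρ ⟨_, leaver_memP hL⟩ : ↥S.rout.𝓟) : Finset ι × Finset ι).1 := by
  have hxy : Disjoint x y := ((mem_negUnitSetF_iff _ _ _).1 ((S.mem_leaverSet _).1 hL).1).1
  set f : ↥S.rout.𝓟 := ⟨_, leaver_memP hL⟩ with hf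
  set w' : Finset ι := ((S.rout.ρ f : ↥S.rout.𝓟) : Finset ι × Finset ι).1 with hw'
  set t' : Finset ι := ((S.rout.ρ f : ↥S.rout.𝓟) : Finset ι × Finset ι).2 with ht'
  have hslot := (S.rout.ρ f).2
  rw [mem_routP_iff] at hslot
  obtain ⟨hw'J, ht'J, hw't', hslotA⟩ := hslot
  have hdom := S.rout.hρ f
  simp only [hf] at hdom
  obtain ⟨hxJt', hyJw'⟩ := hdom
  have hyJw : y ∩ S.J ⊆ w' := by
    refine subset_trans ?_ hyJw'
    intro i hi
    rw [mem_sdiff, mem_union, not_or, mem_sdiff, not_and, not_not]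
    exact ⟨(mem_inter.1 hi).2, fun h => disjoint_left.1 hxy (mem_inter.1 h).1 (mem_inter.1 hi).1, fun _ => hi⟩
  have hQ'R : ∀ s ∈ secHigh (S.J \ w') S.e S.C, s ⊆ S.J \ w' := fun s hs => (mem_secHigh.1 hs).1
  have hslot' := (S.dataJ w').hAa hslotA
  rw [mem_sdiff, mem_image_ground_sdiff _ hQ'R] at hslot'
  obtain ⟨⟨-, ht'Q⟩, -⟩ := hslot'
  have ht'eq : (S.J \ w') \ (S.J \ (w' ∪ t')) = t' := by
    ext i
    simp only [mem_sdiff, mem_union, not_or, not_and, not_not]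
    constructor
    · rintro ⟨⟨hJ, hw⟩, h⟩; exact h hJ hw
    · intro ht; exact ⟨⟨ht'J ht, fun hw => disjoint_left.1 hw't' hw ht⟩, fun _ _ => ht⟩
  rw [ht'eq] at ht'Q
  exact ⟨hw'J, ht'J, hw't', ht'Q, hxJt', hyJw⟩

/-- Traces of the leaver target `(g ∪ t' + e, y_I ∪ w')` (`g ⊆ I`, `t', w' ⊆ J`). [this work] -/
theorem leaver_traces {y g w' t' : Finset ι} (hgI : g ⊆ S.I) (hw'J : w' ⊆ S.J) (ht'J : t' ⊆ S.J) :
    (g ∪ t' ∪ {S.e}) ∩ S.I = g ∧ (g ∪ t' ∪ {S.e}) ∩ S.J = t' ∧ ((y ∩ S.I) ∪ w') ∩ S.I = y ∩ S.I ∧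
      ((y ∩ S.I) ∪ w') ∩ S.J = w' ∧ S.e ∉ (y ∩ S.I) ∪ w' := by
  refine ⟨?_, ?_, inter_union_inter_eq fun i hi hI => disjoint_left.1 S.hIJ hI (hw'J hi),
    inter_union_inter_eq_right S.hIJ hw'J, ?_⟩
  · ext i; simp only [mem_inter, mem_union, mem_singleton]
    constructor
    · rintro ⟨(h | h) | h, hi⟩
      · exact h
      · exact absurd hi (fun hI => disjoint_left.1 S.hIJ hI (ht'J h))
      · exact absurd hi (h ▸ S.heI)
    · intro h; exact ⟨Or.inl (Or.inl h), hgI h⟩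
  · ext i; simp only [mem_inter, mem_union, mem_singleton]
    constructor
    · rintro ⟨(h | h) | h, hi⟩
      · exact absurd (hgI h) (fun hI => disjoint_left.1 S.hIJ hI hi)
      · exact h
      · exact absurd hi (h ▸ S.heJ)
    · intro h; exact ⟨Or.inl (Or.inr h), ht'J h⟩
  · rw [mem_union, not_or]
    exact ⟨fun h => S.heI (mem_inter.1 h).2, fun h => S.heJ (hw'J h)⟩

/-- **Class (S9b), the leavers**: `φ` sends a leaver to the `T1⁺` unit at `(Φ_ℓ(x_I) ∪ x' + e, y_I ∪ y')`,
`(y', x') = ρ(x_J, z_J)`, which dominates it. [this work] -/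
theorem phi_adm_S9b {x y : Finset ι} (hL : ((x, y), 2) ∈ S.leaverSet) :
    S.phi ((x, y), 2) ∈ ThreePartition.posUnitSetF S.B S.C ∧ x ⊆ (S.phi ((x, y), 2)).1.1 ∧ y ⊆ (S.phi ((x, y), 2)).1.2 := by
  have hL' := (S.mem_leaverSet _).1 hL
  obtain ⟨hu, -, hex, hey, -, -⟩ := hL'
  rw [mem_negUnitSetF_iff] at hu
  obtain ⟨hxy, -⟩ := hu
  simp only at hxy hex hey
  obtain ⟨hgR, -, hgQ, hσgP⟩ := img_S9b_I hL
  obtain ⟨hw'J, ht'J, hw't', ht'Q, hxJt', hyJw⟩ := img_S9b_slot hL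
  have hgdom : x ∩ S.I ⊆ ((S.dataI y).Φl ⟨x ∩ S.I, leaver_memI hL⟩ : Finset ι) :=
    (S.dataI y).hΦl ⟨x ∩ S.I, leaver_memI hL⟩
  rw [phi_eq_S9b hL]
  set R := S.I \ (y ∩ S.I) with hR
  set g : Finset ι := ((S.dataI y).Φl ⟨x ∩ S.I, leaver_memI hL⟩ : Finset ι) with hg
  set w' : Finset ι := ((S.rout.ρ ⟨_, leaver_memP hL⟩ : ↥S.rout.𝓟) : Finset ι × Finset ι).1 with hw'
  set t' : Finset ι := ((S.rout.ρ ⟨_, leaver_memP hL⟩ : ↥S.rout.𝓟) : Finset ι × Finset ι).2 with ht'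
  have hgI : g ⊆ S.I := hgR.trans sdiff_subset
  obtain ⟨hx'I, hx'J, hy'I, hy'J, hey'⟩ := leaver_traces (y := y) hgI hw'J ht'J
  have hex' : S.e ∈ g ∪ t' ∪ {S.e} := mem_union_right _ (mem_singleton_self _)
  have hdisj' : Disjoint (g ∪ t' ∪ {S.e}) ((y ∩ S.I) ∪ w') := by
    rw [disjoint_union_left, disjoint_union_left, disjoint_union_right, disjoint_union_right, disjoint_union_right]
    refine ⟨⟨⟨disjoint_left.2 fun i hi h => ?_, disjoint_left.2 fun i hi h => ?_⟩,
      ⟨disjoint_left.2 fun i hi h => ?_, hw't'.symm⟩⟩, ⟨?_, ?_⟩⟩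
    · have := hgR hi; rw [mem_sdiff] at this; exact this.2 h
    · exact disjoint_left.1 S.hIJ (hgI hi) (hw'J h)
    · exact disjoint_left.1 S.hIJ (mem_inter.1 h).2 (ht'J hi)
    · exact disjoint_singleton_left.2 fun h => S.heI (mem_inter.1 h).2
    · exact disjoint_singleton_left.2 fun h => S.heJ (hw'J h)
  have hz'I : ((g ∪ t' ∪ {S.e}) ∪ ((y ∩ S.I) ∪ w'))ᶜ ∩ S.I = R \ g := by
    rw [compl_union_inter_eq, hx'I, hy'I]
  have hez' : S.e ∉ ((g ∪ t' ∪ {S.e}) ∪ ((y ∩ S.I) ∪ w'))ᶜ := by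
    rw [mem_compl, not_not, mem_union]; exact Or.inl hex'
  rw [mem_posUnitSetF_iff]
  refine ⟨⟨hdisj', Or.inl ⟨rfl, ⟨?_, ?_⟩, ?_⟩⟩, ?_, ?_⟩
  · -- `x' ∈ B`: `g ∈ Q`
    refine (mem_B_iff_secHigh (R := R) hex' ?_).2 ?_
    · rw [hx'I]; exact hgR
    · rw [hx'I]; exact hgQ
  · -- `x' ∈ C`: `t' ∈ Q_{w'}`
    refine (mem_C_iff_secHigh (R := S.J \ w') hex' ?_).2 ?_
    · rw [hx'J]; exact (mem_secHigh.1 ht'Q).1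
    · rw [hx'J]; exact ht'Q
  · -- `z' ∉ B`: `e ∉ z'`, `z' ∩ I = σ g ∈ A`, `A ∩ P = ∅`
    intro hz'B
    have h1 := (mem_B_iff_secLow hez' (hz'I ▸ sdiff_subset)).1 hz'B
    rw [hz'I] at h1
    exact hσgP h1
  · -- `x ⊆ x'`
    intro i hi
    rcases S.hcov i with rfl | hI | hJ
    · exact absurd hi hex
    · exact mem_union_left _ (mem_union_left _ (hgdom (mem_inter.2 ⟨hi, hI⟩)))
    · exact mem_union_left _ (mem_union_right _ (hxJt' (mem_inter.2 ⟨hi, hJ⟩)))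
  · -- `y ⊆ y'`
    intro i hi
    rcases S.hcov i with rfl | hI | hJ
    · exact absurd hi hey
    · exact mem_union_left _ (mem_inter.2 ⟨hi, hI⟩)
    · exact mem_union_right _ (hyJw (mem_inter.2 ⟨hi, hJ⟩))

/-- (S9b) signature of the target: `13`. [this work] -/
theorem sig_phi_S9b {x y : Finset ι} (hL : ((x, y), 2) ∈ S.leaverSet) : S.sig (S.phi ((x, y), 2)) = 13 := by
  obtain ⟨hgR, hgT, -, -⟩ := img_S9b_I hL
  obtain ⟨hw'J, ht'J, -, -, -, -⟩ := img_S9b_slot hL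
  have hgI := hgR.trans sdiff_subset
  obtain ⟨hx'I, -, hy'I, -, hey'⟩ := leaver_traces (y := y) hgI hw'J ht'J
  have hv := leaverMap_mem_leaverTargets hL
  rw [leaverMap_eq hL] at hv
  rw [phi_eq_S9b hL]
  refine S.sig_eq_13 rfl hey' (mem_union_right _ (mem_singleton_self _)) ?_ hv
  show (_ ∪ _ ∪ {S.e}) ∩ S.I ∈ (S.dataI ((y ∩ S.I) ∪ _)).A.image (fun t => (S.I \ (((y ∩ S.I) ∪ _) ∩ S.I)) \ t)
  rw [hx'I, ← S.dataI_A_congr hy'I.symm, hy'I]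
  exact hgT

/-- (S9b) `φ` is injective on the leavers. [this work] -/
theorem inj_S9b {x₁ y₁ x₂ y₂ : Finset ι} (hL₁ : ((x₁, y₁), 2) ∈ S.leaverSet) (hL₂ : ((x₂, y₂), 2) ∈ S.leaverSet)
    (h : S.phi ((x₁, y₁), 2) = S.phi ((x₂, y₂), 2)) : ((x₁, y₁), 2) = ((x₂, y₂), 2) := by
  obtain ⟨hu₁, -, hex₁, hey₁, -, -⟩ := (S.mem_leaverSet _).1 hL₁
  obtain ⟨hu₂, -, hex₂, hey₂, -, -⟩ := (S.mem_leaverSet _).1 hL₂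
  have hxy₁ : Disjoint x₁ y₁ := ((mem_negUnitSetF_iff _ _ _).1 hu₁).1
  have hxy₂ : Disjoint x₂ y₂ := ((mem_negUnitSetF_iff _ _ _).1 hu₂).1
  simp only at hex₁ hey₁ hex₂ hey₂
  obtain ⟨hg₁R, -, -, -⟩ := img_S9b_I hL₁
  obtain ⟨hg₂R, -, -, -⟩ := img_S9b_I hL₂
  obtain ⟨hw₁J, ht₁J, -, -, -, -⟩ := img_S9b_slot hL₁
  obtain ⟨hw₂J, ht₂J, -, -, -, -⟩ := img_S9b_slot hL₂
  have hg₁I := hg₁R.trans sdiff_subset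
  have hg₂I := hg₂R.trans sdiff_subset
  obtain ⟨hx₁I, hx₁J, hy₁I, hy₁J, -⟩ := leaver_traces (y := y₁) hg₁I hw₁J ht₁J
  obtain ⟨hx₂I, hx₂J, hy₂I, hy₂J, -⟩ := leaver_traces (y := y₂) hg₂I hw₂J ht₂J
  rw [phi_eq_S9b hL₁, phi_eq_S9b hL₂] at h
  simp only [Prod.mk.injEq, and_true] at h
  obtain ⟨hx, hy⟩ := h
  -- the slot determines `(x_J, z_J)`
  have ht : ((S.rout.ρ ⟨_, leaver_memP hL₁⟩ : ↥S.rout.𝓟) : Finset ι × Finset ι).2 =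
      ((S.rout.ρ ⟨_, leaver_memP hL₂⟩ : ↥S.rout.𝓟) : Finset ι × Finset ι).2 := by
    rw [← hx₁J, ← hx₂J, hx]
  have hw : ((S.rout.ρ ⟨_, leaver_memP hL₁⟩ : ↥S.rout.𝓟) : Finset ι × Finset ι).1 =
      ((S.rout.ρ ⟨_, leaver_memP hL₂⟩ : ↥S.rout.𝓟) : Finset ι × Finset ι).1 := by
    rw [← hy₁J, ← hy₂J, hy]
  have hf := congrArg Subtype.val (S.rout.ρ.injective (Subtype.ext (Prod.ext hw ht)))
  simp only [Prod.mk.injEq] at hf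
  obtain ⟨hxJ, hzJ⟩ := hf
  have hyJ : y₁ ∩ S.J = y₂ ∩ S.J := by
    rw [← Finset.sdiff_sdiff_eq_self (inter_subset_sdiff_inter hxy₁.symm S.J), hzJ, hxJ,
      Finset.sdiff_sdiff_eq_self (inter_subset_sdiff_inter hxy₂.symm S.J)]
  have hyI : y₁ ∩ S.I = y₂ ∩ S.I := by rw [← hy₁I, ← hy₂I, hy]
  obtain rfl : y₁ = y₂ := part_eq_of_traces ⟨fun h => absurd h hey₁, fun h => absurd h hey₂⟩ hyI hyJ
  -- now `Φ_ℓ` of the common column is injective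
  have hg : ((S.dataI y₁).Φl ⟨x₁ ∩ S.I, leaver_memI hL₁⟩ : Finset ι) =
      ((S.dataI y₁).Φl ⟨x₂ ∩ S.I, leaver_memI hL₂⟩ : Finset ι) := by
    rw [← hx₁I, ← hx₂I, hx]
  have hxI : x₁ ∩ S.I = x₂ ∩ S.I := congrArg Subtype.val ((S.dataI y₁).Φl.injective (Subtype.ext hg))
  rw [part_eq_of_traces (s := x₁) (s' := x₂) ⟨fun h => absurd h hex₁, fun h => absurd h hex₂⟩ hxI hxJ]

end OneShared

end SahiFComb.Shift

end Summit.CriticalPhenomena.PercolationContinuityZ3.Theorems
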